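import Summits.ValiantsHypothesis.ValiantsHypothesis.Theorems.LacunarySymmetroidMatrixDescartesPivotRankOneOneThreeKillSevenOdd
import Summits.ValiantsHypothesis.ValiantsHypothesis.Theorems.LacunarySymmetroidMatrixDescartesPivotRankOneOneThreeKillSevenParOP

/-!
# `MatrixDescartes` census — rank-one `(2,4)₁`, ONE below / THREE above, chamber (C): `Z₊ ≤ 7` BY PARITY under the parallelogram kill-seven sets
# (`{p02,p03,p12,p13}`, `{s2,p12,s3,p13}` of `…ParOP`)

HONEST FRAMING.  Object-search cell `pub-symmetroid`, seat `val-sym-mdr-p1` (generation 26); helper file `--supports` the crux item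
stmt-ValiantsHypothesis-18050 (`Theses.LacunarySymmetroid.MatrixDescartes`, OPEN, on HOLD) with NO closure claim.  Companion of
`…OneThreeKillSevenOdd` (four-nomial terminal with multiplicity) and `…OneThreeKillEightOdd` (parity of the `1|3` eleven-nomial): the
generation-16 weight-free parallelogram kill-seven theorems of `…OneThreeKillSevenPar*` («condition ⇒ `Z₊ ≤ 8`», chamber (C) of the split
`d₀ < e < d₁ < d₂ < d₃`) repeated VERBATIM with the kills counted WITH multiplicity, then Descartes' parity (letter `0` core, letters `2, 3` not
parallel ⇒ odd count) ⇒ **`Z₊ ≤ 7`**, real-parameter and matrix forms.  No covering theorem and no register move is claimed; the certificate-free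
part of chamber (C) stays OPEN.  Nothing here bears on `MatrixDescartes` in its window, on `DoorA26` / `DoorA34`, registers / credences, or `VP ≠ VNP`.

[folklore] Tree kill engine with multiplicity; Descartes' parity [cite: BasuPollackRoy2006, Thm. 2.33] through the tree.  No definitions, no named facts.
-/

-- `Summit.ValiantsHypothesis.ValiantsHypothesis.…` repeats a component by the D-0017 layout
-- (single-conjunct summit), which the `dupNamespace` linter flags; the name is mandated.
set_option linter.dupNamespace false

namespace Summit.ValiantsHypothesis.ValiantsHypothesis.Theorems.LacunarySymmetroidMatrixDescartes.Pivot.TwoDirections.BlockLaw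

open Polynomial Matrix Finset
open scoped BigOperators
open Summit.ValiantsHypothesis.ValiantsHypothesis.Theorems.LacunarySymmetroidMatrixDescartes.Pivot.KillMult
  (countP_posRoots_le_kills odd_countP_posRoots card_posRoots_le_pred_of_odd)

/-! ## 1. The sets of `…ParOP` -/

/-- **elevenNomial_chamberC_par_p02p03p12p13: `Z₊ ≤ 7`.**  As the tree's `elevenNomial_chamberC_par_p02p03p12p13_le_eight` (same exponent hypotheses and kill condition, coefficient data otherwise arbitrary) plus the
sign hypotheses that make the count odd (letter `0` core: `m₀ < 0`; letters `2, 3` not parallel: `D₂₃ > 0`; positive weights): the kills counted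
WITH multiplicity give `pos ≤ 8` with multiplicity, and parity gives `7`. -/
theorem elevenNomial_chamberC_par_p02p03p12p13_le_seven (e d₀ d₁ d₂ d₃ : ℕ) (h0e : d₀ < e) (he1 : e < d₁) (h12 : d₁ < d₂) (h23 : d₂ < d₃)
    (hC1 : d₀ + d₁ < 2 * e) (hC2 : 2 * e < d₀ + d₂) (hC3 : d₀ + d₂ < e + d₁) (hC4 : e + d₁ < d₀ + d₃) (hC5 : d₀ + d₃ < e + d₂) (hC6 : d₁ + d₂ < e + d₃)
    (dJ m₀ m₁ m₂ m₃ w₀ w₁ w₂ w₃ D01 D02 D03 D12 D13 D23 : ℝ) (hw₀ : 0 < w₀) (hw₁ : 0 < w₁) (hw₂ : 0 < w₂) (hw₃ : 0 < w₃) (hD03 : 0 < D03) (hD13 : 0 < D13) (hm₀ : m₀ < 0) (hD23 : 0 < D23)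
    (hS : (D03 * (((d₀ : ℝ) + d₃ - 2 * e) * ((d₃ : ℝ) - e) * ((d₀ : ℝ) + d₃ - e - d₁) * ((e : ℝ) + d₂ - d₀ - d₃) * ((e : ℝ) - d₀) * ((d₃ : ℝ) - d₁) * ((d₂ : ℝ) - d₀))) * ((D12 * (((d₁ : ℝ) + d₂ - 2 * e) * ((d₁ : ℝ) + d₂ - e - d₀) * ((d₂ : ℝ) - e) * ((d₁ : ℝ) - e) * ((e : ℝ) + d₃ - d₁ - d₂) * ((d₂ : ℝ) - d₀) * ((d₃ : ℝ) - d₁)))) ≤ ((D02 * (((d₀ : ℝ) + d₂ - 2 * e) * ((d₂ : ℝ) - e) * ((e : ℝ) + d₁ - d₀ - d₂) * ((e : ℝ) - d₀) * ((e : ℝ) + d₃ - d₀ - d₂) * ((d₂ : ℝ) - d₁) * ((d₃ : ℝ) - d₀)))) * (D13 * (((d₁ : ℝ) + d₃ - 2 * e) * ((d₁ : ℝ) + d₃ - e - d₀) * ((d₃ : ℝ) - e) * ((d₁ : ℝ) + d₃ - e - d₂) * ((d₁ : ℝ) - e) * ((d₃ : ℝ) - d₀) * ((d₂ : ℝ)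 - d₁)))) :
    ((∑ i : Fin 11, Polynomial.C ((![dJ, w₀ * m₀, w₁ * m₁, w₂ * m₂, w₃ * m₃, w₀ * w₁ * D01, w₀ * w₂ * D02, w₀ * w₃ * D03, w₁ * w₂ * D12, w₁ * w₃ * D13, w₂ * w₃ * D23] : Fin 11 → ℝ) i) * X ^ ((![2 * e, e + d₀, e + d₁, e + d₂, e + d₃, d₀ + d₁, d₀ + d₂, d₀ + d₃, d₁ + d₂, d₁ + d₃, d₂ + d₃] : Fin 11 → ℕ) i)).roots.toFinset.filter (fun t => 0 < t)).card ≤ 7 := by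
  classical
  have h8 : (∑ i : Fin 11, Polynomial.C ((![dJ, w₀ * m₀, w₁ * m₁, w₂ * m₂, w₃ * m₃, w₀ * w₁ * D01, w₀ * w₂ * D02, w₀ * w₃ * D03, w₁ * w₂ * D12, w₁ * w₃ * D13, w₂ * w₃ * D23] : Fin 11 → ℝ) i) * X ^ ((![2 * e, e + d₀, e + d₁, e + d₂, e + d₃, d₀ + d₁, d₀ + d₂, d₀ + d₃, d₁ + d₂, d₁ + d₃, d₂ + d₃] : Fin 11 → ℕ) i)).roots.countP (fun x => 0 < x) ≤ 8 := by
    have h0e' : (d₀ : ℝ) < e := by exact_mod_cast h0e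
    have he1' : (e : ℝ) < d₁ := by exact_mod_cast he1
    have h12' : (d₁ : ℝ) < d₂ := by exact_mod_cast h12
    have h23' : (d₂ : ℝ) < d₃ := by exact_mod_cast h23
    have hC1' : (d₀ : ℝ) + d₁ < 2 * e := by exact_mod_cast hC1
    have hC2' : 2 * (e : ℝ) < d₀ + d₂ := by exact_mod_cast hC2
    have hC3' : (d₀ : ℝ) + d₂ < e + d₁ := by exact_mod_cast hC3
    have hC4' : (e : ℝ) + d₁ < d₀ + d₃ := by exact_mod_cast hC4
    have hC5' : (d₀ : ℝ) + d₃ < e + d₂ := by exact_mod_cast hC5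
    have hC6' : (d₁ : ℝ) + d₂ < e + d₃ := by exact_mod_cast hC6
    obtain ⟨PA, hPA⟩ : ∃ x : ℝ, x = ((d₀ : ℝ) + d₂ - 2 * e) * ((d₂ : ℝ) - e) * ((e : ℝ) + d₁ - d₀ - d₂) * ((e : ℝ) - d₀) * ((e : ℝ) + d₃ - d₀ - d₂) * ((d₂ : ℝ) - d₁) * ((d₃ : ℝ) - d₀) := ⟨_, rfl⟩
    obtain ⟨PB, hPB⟩ : ∃ x : ℝ, x = ((d₀ : ℝ) + d₃ - 2 * e) * ((d₃ : ℝ) - e) * ((d₀ : ℝ) + d₃ - e - d₁) * ((e : ℝ) + d₂ - d₀ - d₃) * ((e : ℝ) - d₀) * ((d₃ : ℝ) - d₁) * ((d₂ : ℝ) - d₀) := ⟨_, rfl⟩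
    obtain ⟨PC, hPC⟩ : ∃ x : ℝ, x = ((d₁ : ℝ) + d₂ - 2 * e) * ((d₁ : ℝ) + d₂ - e - d₀) * ((d₂ : ℝ) - e) * ((d₁ : ℝ) - e) * ((e : ℝ) + d₃ - d₁ - d₂) * ((d₂ : ℝ) - d₀) * ((d₃ : ℝ) - d₁) := ⟨_, rfl⟩
    obtain ⟨PD, hPD⟩ : ∃ x : ℝ, x = ((d₁ : ℝ) + d₃ - 2 * e) * ((d₁ : ℝ) + d₃ - e - d₀) * ((d₃ : ℝ) - e) * ((d₁ : ℝ) + d₃ - e - d₂) * ((d₁ : ℝ) - e) * ((d₃ : ℝ) - d₀) * ((d₂ : ℝ) - d₁) := ⟨_, rfl⟩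
    have hS' : (D03 * PB) * ((D12 * PC)) ≤ ((D02 * PA)) * (D13 * PD) := by
      rw [hPA, hPB, hPC, hPD]; exact hS
    clear hS
    have hPBp : 0 < PB := by
      rw [hPB]
      have f1 : 0 < ((d₀ : ℝ) + d₃ - 2 * e) := by linarith only [h0e', he1', h12', h23', hC1', hC2', hC3', hC4', hC5', hC6']
      have f2 : 0 < ((d₃ : ℝ) - e) := by linarith only [h0e', he1', h12', h23', hC1', hC2', hC3', hC4', hC5', hC6']
      have f3 : 0 < ((d₀ : ℝ) + d₃ - e - d₁) := by linarith only [h0e', he1', h12', h23', hC1', hC2', hC3', hC4', hC5', hC6']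
      have f4 : 0 < ((e : ℝ) + d₂ - d₀ - d₃) := by linarith only [h0e', he1', h12', h23', hC1', hC2', hC3', hC4', hC5', hC6']
      have f5 : 0 < ((e : ℝ) - d₀) := by linarith only [h0e', he1', h12', h23', hC1', hC2', hC3', hC4', hC5', hC6']
      have f6 : 0 < ((d₃ : ℝ) - d₁) := by linarith only [h0e', he1', h12', h23', hC1', hC2', hC3', hC4', hC5', hC6']
      have f7 : 0 < ((d₂ : ℝ) - d₀) := by linarith only [h0e', he1', h12', h23', hC1', hC2', hC3', hC4', hC5', hC6']
      exact mul_pos (mul_pos (mul_pos (mul_pos (mul_pos (mul_pos f1 f2) f3) f4) f5) f6) f7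
    have hPDp : 0 < PD := by
      rw [hPD]
      have f1 : 0 < ((d₁ : ℝ) + d₃ - 2 * e) := by linarith only [h0e', he1', h12', h23', hC1', hC2', hC3', hC4', hC5', hC6']
      have f2 : 0 < ((d₁ : ℝ) + d₃ - e - d₀) := by linarith only [h0e', he1', h12', h23', hC1', hC2', hC3', hC4', hC5', hC6']
      have f3 : 0 < ((d₃ : ℝ) - e) := by linarith only [h0e', he1', h12', h23', hC1', hC2', hC3', hC4', hC5', hC6']
      have f4 : 0 < ((d₁ : ℝ) + d₃ - e - d₂) := by linarith only [h0e', he1', h12', h23', hC1', hC2', hC3', hC4', hC5', hC6']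
      have f5 : 0 < ((d₁ : ℝ) - e) := by linarith only [h0e', he1', h12', h23', hC1', hC2', hC3', hC4', hC5', hC6']
      have f6 : 0 < ((d₃ : ℝ) - d₀) := by linarith only [h0e', he1', h12', h23', hC1', hC2', hC3', hC4', hC5', hC6']
      have f7 : 0 < ((d₂ : ℝ) - d₁) := by linarith only [h0e', he1', h12', h23', hC1', hC2', hC3', hC4', hC5', hC6']
      exact mul_pos (mul_pos (mul_pos (mul_pos (mul_pos (mul_pos f1 f2) f3) f4) f5) f6) f7
    obtain ⟨A, hA⟩ : ∃ x : ℝ, x = (w₀ * w₂ * D02 * PA) := ⟨_, rfl⟩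
    obtain ⟨B, hB⟩ : ∃ x : ℝ, x = w₀ * w₃ * D03 * PB := ⟨_, rfl⟩
    obtain ⟨C, hC⟩ : ∃ x : ℝ, x = (w₁ * w₂ * D12 * PC) := ⟨_, rfl⟩
    obtain ⟨D, hD⟩ : ∃ x : ℝ, x = w₁ * w₃ * D13 * PD := ⟨_, rfl⟩
    have hBp : 0 < B := by rw [hB]; exact mul_pos (mul_pos (mul_pos hw₀ hw₃) hD03) hPBp
    have hDp : 0 < D := by rw [hD]; exact mul_pos (mul_pos (mul_pos hw₁ hw₃) hD13) hPDp
    have hBC : B * C ≤ A * D := by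
      have e1 : B * C = (w₀ * w₁ * w₂ * w₃) * ((D03 * PB) * ((D12 * PC))) := by rw [hB, hC]; ring
      have e2 : A * D = (w₀ * w₁ * w₂ * w₃) * (((D02 * PA)) * (D13 * PD)) := by rw [hA, hD]; ring
      rw [e1, e2]
      exact mul_le_mul_of_nonneg_left hS' (by positivity)
    have hkills := countP_posRoots_le_kills (Finset.univ : Finset (Fin 11)) (![2 * e, e + d₀, e + d₁, e + d₂, e + d₃, d₀ + d₁, d₀ + d₂, d₀ + d₃, d₁ + d₂, d₁ + d₃, d₂ + d₃] : Fin 11 → ℕ) [2 * e, e + d₀, e + d₁, e + d₂, e + d₃, d₀ + d₁, d₂ + d₃] (![dJ, w₀ * m₀, w₁ * m₁, w₂ * m₂, w₃ * m₃, w₀ * w₁ * D01, w₀ * w₂ * D02, w₀ * w₃ * D03, w₁ * w₂ * D12, w₁ * w₃ * D13, w₂ * w₃ * D23] : Fin 11 → ℝ)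
    have hfour : (∑ i ∈ (Finset.univ : Finset (Fin 11)), Polynomial.C ((![dJ, w₀ * m₀, w₁ * m₁, w₂ * m₂, w₃ * m₃, w₀ * w₁ * D01, w₀ * w₂ * D02, w₀ * w₃ * D03, w₁ * w₂ * D12, w₁ * w₃ * D13, w₂ * w₃ * D23] : Fin 11 → ℝ) i
            * (([2 * e, e + d₀, e + d₁, e + d₂, e + d₃, d₀ + d₁, d₂ + d₃]).map (fun ρ : ℕ => (((((![2 * e, e + d₀, e + d₁, e + d₂, e + d₃, d₀ + d₁, d₀ + d₂, d₀ + d₃, d₁ + d₂, d₁ + d₃, d₂ + d₃] : Fin 11 → ℕ)) i : ℕ) : ℝ) - (ρ : ℝ)))).prod) * X ^ ((![2 * e, e + d₀, e + d₁, e + d₂, e + d₃, d₀ + d₁, d₀ + d₂, d₀ + d₃, d₁ + d₂, d₁ + d₃, d₂ + d₃] : Fin 11 → ℕ) i))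
        = (Polynomial.C A * X ^ (d₀ + d₂) - Polynomial.C B * X ^ (d₀ + d₂ + (d₃ - d₂))
            + Polynomial.C C * X ^ (d₀ + d₂ + (d₁ - d₀)) - Polynomial.C D * X ^ (d₀ + d₂ + (d₃ - d₂) + (d₁ - d₀))) := by
      have e3 : d₀ + d₂ + (d₃ - d₂) + (d₁ - d₀) = d₁ + d₃ := by omega
      have e1 : d₀ + d₂ + (d₃ - d₂) = d₀ + d₃ := by omega
      have e2 : d₀ + d₂ + (d₁ - d₀) = d₁ + d₂ := by omega
      rw [e3, e1, e2]
      have hcoef : ∀ i : Fin 11, (![dJ, w₀ * m₀, w₁ * m₁, w₂ * m₂, w₃ * m₃, w₀ * w₁ * D01, w₀ * w₂ * D02, w₀ * w₃ * D03, w₁ * w₂ * D12, w₁ * w₃ * D13, w₂ * w₃ * D23] : Fin 11 → ℝ) i * (([2 * e, e + d₀, e + d₁, e + d₂, e + d₃, d₀ + d₁, d₂ + d₃]).map (fun ρ : ℕ => (((((![2 * e, e + d₀, e + d₁, e + d₂, e + d₃, d₀ + d₁, d₀ + d₂, d₀ + d₃, d₁ + d₂, d₁ + d₃, d₂ + d₃]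 : Fin 11 → ℕ)) i : ℕ) : ℝ) - (ρ : ℝ)))).prod
          = (![0, 0, 0, 0, 0, 0, A, -B, C, -D, 0] : Fin 11 → ℝ) i := by
        intro i
        fin_cases i <;>
          simp only [Fin.zero_eta, Fin.mk_one, Fin.isValue, Matrix.cons_val_zero, Matrix.cons_val_one,
            List.map_cons, List.map_nil, List.prod_cons, List.prod_nil, hA, hB, hC, hD, hPA, hPB, hPC, hPD] <;>
          push_cast <;> ring
      rw [Finset.sum_congr rfl (fun i _ => by rw [hcoef i])]
      simp only [Fin.sum_univ_succ, Fin.sum_univ_zero, Matrix.cons_val_zero, Matrix.cons_val_succ, map_zero, zero_mul,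
        zero_add, add_zero, Polynomial.C_neg]
      ring
    rw [hfour] at hkills
    have hone := countP_posRoots_fourNomial_le_one A B C D hBp hDp hBC (d₀ + d₂) (d₃ - d₂) (d₁ - d₀) (by omega)
    simp only [List.length_cons, List.length_nil] at hkills
    omega
  have hodd := elevenNomial_oneThree_odd e d₀ d₁ d₂ d₃ h0e he1 h12 h23 dJ m₀ m₁ m₂ m₃ w₀ w₁ w₂ w₃ D01 D02 D03 D12 D13 D23
    (mul_neg_of_pos_of_neg hw₀ hm₀) (mul_pos (mul_pos hw₂ hw₃) hD23)
  have h7 := card_posRoots_le_pred_of_odd _ 4 hodd (by omega)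
  omega

/-- **Matrix form: `Z₊ ≤ 7`** (as the tree's `oneThree_rankOne_posRoots_le_eight_of_par_p02p03p12p13`, plus letter `0` core, letters `2, 3` not parallel, positive weights). -/
theorem oneThree_rankOne_posRoots_le_seven_of_par_p02p03p12p13 (e d₀ d₁ d₂ d₃ : ℕ) (h0e : d₀ < e) (he1 : e < d₁) (h12 : d₁ < d₂)
    (h23 : d₂ < d₃) (hC1 : d₀ + d₁ < 2 * e) (hC2 : 2 * e < d₀ + d₂) (hC3 : d₀ + d₂ < e + d₁) (hC4 : e + d₁ < d₀ + d₃)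
    (hC5 : d₀ + d₃ < e + d₂) (hC6 : d₁ + d₂ < e + d₃)
    (J : Matrix (Fin 2) (Fin 2) ℝ) (v₀ v₁ v₂ v₃ : Fin 2 → ℝ) (w₀ w₁ w₂ w₃ : ℝ) (hw₀ : 0 < w₀) (hw₁ : 0 < w₁) (hw₂ : 0 < w₂) (hw₃ : 0 < w₃) (hD03 : 0 < ((v₀ 0 * v₃ 1 - v₀ 1 * v₃ 0) ^ 2)) (hD13 : 0 < ((v₁ 0 * v₃ 1 - v₁ 1 * v₃ 0) ^ 2))
    (hm₀ : (J 0 0 * v₀ 1 ^ 2 + J 1 1 * v₀ 0 ^ 2 - (J 0 1 + J 1 0) * (v₀ 0 * v₀ 1)) < 0) (hD23 : 0 < (v₂ 0 * v₃ 1 - v₂ 1 * v₃ 0) ^ 2)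
    (hS : (((v₀ 0 * v₃ 1 - v₀ 1 * v₃ 0) ^ 2) * (((d₀ : ℝ) + d₃ - 2 * e) * ((d₃ : ℝ) - e) * ((d₀ : ℝ) + d₃ - e - d₁) * ((e : ℝ) + d₂ - d₀ - d₃) * ((e : ℝ) - d₀) * ((d₃ : ℝ) - d₁) * ((d₂ : ℝ) - d₀))) * ((((v₁ 0 * v₂ 1 - v₁ 1 * v₂ 0) ^ 2) * (((d₁ : ℝ) + d₂ - 2 * e) * ((d₁ : ℝ) + d₂ - e - d₀) * ((d₂ : ℝ) - e) * ((d₁ : ℝ) - e) * ((e : ℝ) + d₃ - d₁ - d₂) * ((d₂ : ℝ) - d₀) * ((d₃ : ℝ) - d₁)))) ≤ ((((v₀ 0 * v₂ 1 - v₀ 1 * v₂ 0) ^ 2) * (((d₀ : ℝ) + d₂ - 2 * e) * ((d₂ : ℝ) - e) * ((e : ℝ) + d₁ - d₀ - d₂) * ((e : ℝ) - d₀) * ((e : ℝ) + d₃ - d₀ - d₂) * ((d₂ : ℝ) - d₁) * ((d₃ : ℝ) - d₀)))) * (((v₁ 0 * v₃ 1 - v₁ 1 * v₃ 0) ^ 2)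 * (((d₁ : ℝ) + d₃ - 2 * e) * ((d₁ : ℝ) + d₃ - e - d₀) * ((d₃ : ℝ) - e) * ((d₁ : ℝ) + d₃ - e - d₂) * ((d₁ : ℝ) - e) * ((d₃ : ℝ) - d₀) * ((d₂ : ℝ) - d₁)))) :
    ((Matrix.det (((X : ℝ[X]) ^ e) • J.map Polynomial.C
        + (Polynomial.C w₀ * X ^ d₀) • (vecMulVec v₀ v₀).map Polynomial.C
        + (Polynomial.C w₁ * X ^ d₁) • (vecMulVec v₁ v₁).map Polynomial.C
        + (Polynomial.C w₂ * X ^ d₂) • (vecMulVec v₂ v₂).map Polynomial.C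
        + (Polynomial.C w₃ * X ^ d₃) • (vecMulVec v₃ v₃).map Polynomial.C)).roots.toFinset.filter (fun t => 0 < t)).card
      ≤ 7 := by
  rw [det_rankOne_four_sum]
  exact elevenNomial_chamberC_par_p02p03p12p13_le_seven e d₀ d₁ d₂ d₃ h0e he1 h12 h23 hC1 hC2 hC3 hC4 hC5 hC6 J.det _ _ _ _ w₀ w₁ w₂ w₃ _ _ _ _ _ _
    hw₀ hw₁ hw₂ hw₃ hD03 hD13 hm₀ hD23 hS

/-- **elevenNomial_chamberC_par_s2p12s3p13: `Z₊ ≤ 7`.**  As the tree's `elevenNomial_chamberC_par_s2p12s3p13_le_eight` (same exponent hypotheses and kill condition, coefficient data otherwise arbitrary) plus the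
sign hypotheses that make the count odd (letter `0` core: `m₀ < 0`; letters `2, 3` not parallel: `D₂₃ > 0`; positive weights): the kills counted
WITH multiplicity give `pos ≤ 8` with multiplicity, and parity gives `7`. -/
theorem elevenNomial_chamberC_par_s2p12s3p13_le_seven (e d₀ d₁ d₂ d₃ : ℕ) (h0e : d₀ < e) (he1 : e < d₁) (h12 : d₁ < d₂) (h23 : d₂ < d₃)
    (hC1 : d₀ + d₁ < 2 * e) (hC2 : 2 * e < d₀ + d₂) (hC3 : d₀ + d₂ < e + d₁) (hC4 : e + d₁ < d₀ + d₃) (hC5 : d₀ + d₃ < e + d₂) (hC6 : d₁ + d₂ < e + d₃)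
    (dJ m₀ m₁ m₂ m₃ w₀ w₁ w₂ w₃ D01 D02 D03 D12 D13 D23 : ℝ) (hw₁ : 0 < w₁) (hw₂ : 0 < w₂) (hw₃ : 0 < w₃) (hD12 : 0 < D12) (hD13 : 0 < D13) (hw₀ : 0 < w₀) (hm₀ : m₀ < 0) (hD23 : 0 < D23)
    (hS : (D12 * (((d₁ : ℝ) + d₂ - 2 * e) * ((d₁ : ℝ) + d₂ - e - d₀) * ((d₂ : ℝ) - e) * ((d₂ : ℝ) - d₀) * ((d₁ : ℝ) - d₀) * ((d₁ : ℝ) + d₂ - d₀ - d₃) * ((d₃ : ℝ) - d₁))) * (((-m₃) * (((d₃ : ℝ) - e) * ((d₃ : ℝ) - d₀) * ((d₃ : ℝ) - d₁) * ((e : ℝ) + d₃ - d₀ - d₁) * ((e : ℝ) + d₃ - d₀ - d₂) * ((e : ℝ) - d₀) * ((d₂ : ℝ) - e)))) ≤ (((-m₂) * (((d₂ : ℝ) - e) * ((d₂ : ℝ) - d₀) * ((d₂ : ℝ) - d₁) * ((e : ℝ) + d₂ - d₀ - d₁) * ((e : ℝ) - d₀) * ((e : ℝ) + d₂ - d₀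 - d₃) * ((d₃ : ℝ) - e)))) * (D13 * (((d₁ : ℝ) + d₃ - 2 * e) * ((d₁ : ℝ) + d₃ - e - d₀) * ((d₃ : ℝ) - e) * ((d₃ : ℝ) - d₀) * ((d₁ : ℝ) + d₃ - d₀ - d₂) * ((d₁ : ℝ) - d₀) * ((d₂ : ℝ) - d₁)))) :
    ((∑ i : Fin 11, Polynomial.C ((![dJ, w₀ * m₀, w₁ * m₁, w₂ * m₂, w₃ * m₃, w₀ * w₁ * D01, w₀ * w₂ * D02, w₀ * w₃ * D03, w₁ * w₂ * D12, w₁ * w₃ * D13, w₂ * w₃ * D23] : Fin 11 → ℝ) i) * X ^ ((![2 * e, e + d₀, e + d₁, e + d₂, e + d₃, d₀ + d₁, d₀ + d₂, d₀ + d₃, d₁ + d₂, d₁ + d₃, d₂ + d₃] : Fin 11 → ℕ) i)).roots.toFinset.filter (fun t => 0 < t)).card ≤ 7 := by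
  classical
  have h8 : (∑ i : Fin 11, Polynomial.C ((![dJ, w₀ * m₀, w₁ * m₁, w₂ * m₂, w₃ * m₃, w₀ * w₁ * D01, w₀ * w₂ * D02, w₀ * w₃ * D03, w₁ * w₂ * D12, w₁ * w₃ * D13, w₂ * w₃ * D23] : Fin 11 → ℝ) i) * X ^ ((![2 * e, e + d₀, e + d₁, e + d₂, e + d₃, d₀ + d₁, d₀ + d₂, d₀ + d₃, d₁ + d₂, d₁ + d₃, d₂ + d₃] : Fin 11 → ℕ) i)).roots.countP (fun x => 0 < x) ≤ 8 := by
    have h0e' : (d₀ : ℝ) < e := by exact_mod_cast h0e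
    have he1' : (e : ℝ) < d₁ := by exact_mod_cast he1
    have h12' : (d₁ : ℝ) < d₂ := by exact_mod_cast h12
    have h23' : (d₂ : ℝ) < d₃ := by exact_mod_cast h23
    have hC1' : (d₀ : ℝ) + d₁ < 2 * e := by exact_mod_cast hC1
    have hC2' : 2 * (e : ℝ) < d₀ + d₂ := by exact_mod_cast hC2
    have hC3' : (d₀ : ℝ) + d₂ < e + d₁ := by exact_mod_cast hC3
    have hC4' : (e : ℝ) + d₁ < d₀ + d₃ := by exact_mod_cast hC4
    have hC5' : (d₀ : ℝ) + d₃ < e + d₂ := by exact_mod_cast hC5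
    have hC6' : (d₁ : ℝ) + d₂ < e + d₃ := by exact_mod_cast hC6
    obtain ⟨PA, hPA⟩ : ∃ x : ℝ, x = ((d₂ : ℝ) - e) * ((d₂ : ℝ) - d₀) * ((d₂ : ℝ) - d₁) * ((e : ℝ) + d₂ - d₀ - d₁) * ((e : ℝ) - d₀) * ((e : ℝ) + d₂ - d₀ - d₃) * ((d₃ : ℝ) - e) := ⟨_, rfl⟩
    obtain ⟨PB, hPB⟩ : ∃ x : ℝ, x = ((d₁ : ℝ) + d₂ - 2 * e) * ((d₁ : ℝ) + d₂ - e - d₀) * ((d₂ : ℝ) - e) * ((d₂ : ℝ) - d₀) * ((d₁ : ℝ) - d₀) * ((d₁ : ℝ) + d₂ - d₀ - d₃) * ((d₃ : ℝ) - d₁) := ⟨_, rfl⟩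
    obtain ⟨PC, hPC⟩ : ∃ x : ℝ, x = ((d₃ : ℝ) - e) * ((d₃ : ℝ) - d₀) * ((d₃ : ℝ) - d₁) * ((e : ℝ) + d₃ - d₀ - d₁) * ((e : ℝ) + d₃ - d₀ - d₂) * ((e : ℝ) - d₀) * ((d₂ : ℝ) - e) := ⟨_, rfl⟩
    obtain ⟨PD, hPD⟩ : ∃ x : ℝ, x = ((d₁ : ℝ) + d₃ - 2 * e) * ((d₁ : ℝ) + d₃ - e - d₀) * ((d₃ : ℝ) - e) * ((d₃ : ℝ) - d₀) * ((d₁ : ℝ) + d₃ - d₀ - d₂) * ((d₁ : ℝ) - d₀) * ((d₂ : ℝ) - d₁) := ⟨_, rfl⟩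
    have hS' : (D12 * PB) * (((-m₃) * PC)) ≤ (((-m₂) * PA)) * (D13 * PD) := by
      rw [hPA, hPB, hPC, hPD]; exact hS
    clear hS
    have hPBp : 0 < PB := by
      rw [hPB]
      have f1 : 0 < ((d₁ : ℝ) + d₂ - 2 * e) := by linarith only [h0e', he1', h12', h23', hC1', hC2', hC3', hC4', hC5', hC6']
      have f2 : 0 < ((d₁ : ℝ) + d₂ - e - d₀) := by linarith only [h0e', he1', h12', h23', hC1', hC2', hC3', hC4', hC5', hC6']
      have f3 : 0 < ((d₂ : ℝ) - e) := by linarith only [h0e', he1', h12', h23', hC1', hC2', hC3', hC4', hC5', hC6']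
      have f4 : 0 < ((d₂ : ℝ) - d₀) := by linarith only [h0e', he1', h12', h23', hC1', hC2', hC3', hC4', hC5', hC6']
      have f5 : 0 < ((d₁ : ℝ) - d₀) := by linarith only [h0e', he1', h12', h23', hC1', hC2', hC3', hC4', hC5', hC6']
      have f6 : 0 < ((d₁ : ℝ) + d₂ - d₀ - d₃) := by linarith only [h0e', he1', h12', h23', hC1', hC2', hC3', hC4', hC5', hC6']
      have f7 : 0 < ((d₃ : ℝ) - d₁) := by linarith only [h0e', he1', h12', h23', hC1', hC2', hC3', hC4', hC5', hC6']
      exact mul_pos (mul_pos (mul_pos (mul_pos (mul_pos (mul_pos f1 f2) f3) f4) f5) f6) f7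
    have hPDp : 0 < PD := by
      rw [hPD]
      have f1 : 0 < ((d₁ : ℝ) + d₃ - 2 * e) := by linarith only [h0e', he1', h12', h23', hC1', hC2', hC3', hC4', hC5', hC6']
      have f2 : 0 < ((d₁ : ℝ) + d₃ - e - d₀) := by linarith only [h0e', he1', h12', h23', hC1', hC2', hC3', hC4', hC5', hC6']
      have f3 : 0 < ((d₃ : ℝ) - e) := by linarith only [h0e', he1', h12', h23', hC1', hC2', hC3', hC4', hC5', hC6']
      have f4 : 0 < ((d₃ : ℝ) - d₀) := by linarith only [h0e', he1', h12', h23', hC1', hC2', hC3', hC4', hC5', hC6']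
      have f5 : 0 < ((d₁ : ℝ) + d₃ - d₀ - d₂) := by linarith only [h0e', he1', h12', h23', hC1', hC2', hC3', hC4', hC5', hC6']
      have f6 : 0 < ((d₁ : ℝ) - d₀) := by linarith only [h0e', he1', h12', h23', hC1', hC2', hC3', hC4', hC5', hC6']
      have f7 : 0 < ((d₂ : ℝ) - d₁) := by linarith only [h0e', he1', h12', h23', hC1', hC2', hC3', hC4', hC5', hC6']
      exact mul_pos (mul_pos (mul_pos (mul_pos (mul_pos (mul_pos f1 f2) f3) f4) f5) f6) f7
    obtain ⟨A, hA⟩ : ∃ x : ℝ, x = (w₂ * (-m₂) * PA) := ⟨_, rfl⟩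
    obtain ⟨B, hB⟩ : ∃ x : ℝ, x = w₁ * w₂ * D12 * PB := ⟨_, rfl⟩
    obtain ⟨C, hC⟩ : ∃ x : ℝ, x = (w₃ * (-m₃) * PC) := ⟨_, rfl⟩
    obtain ⟨D, hD⟩ : ∃ x : ℝ, x = w₁ * w₃ * D13 * PD := ⟨_, rfl⟩
    have hBp : 0 < B := by rw [hB]; exact mul_pos (mul_pos (mul_pos hw₁ hw₂) hD12) hPBp
    have hDp : 0 < D := by rw [hD]; exact mul_pos (mul_pos (mul_pos hw₁ hw₃) hD13) hPDp
    have hBC : B * C ≤ A * D := by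
      have e1 : B * C = (w₁ * w₂ * w₃) * ((D12 * PB) * (((-m₃) * PC))) := by rw [hB, hC]; ring
      have e2 : A * D = (w₁ * w₂ * w₃) * ((((-m₂) * PA)) * (D13 * PD)) := by rw [hA, hD]; ring
      rw [e1, e2]
      exact mul_le_mul_of_nonneg_left hS' (by positivity)
    have hkills := countP_posRoots_le_kills (Finset.univ : Finset (Fin 11)) (![2 * e, e + d₀, e + d₁, e + d₂, e + d₃, d₀ + d₁, d₀ + d₂, d₀ + d₃, d₁ + d₂, d₁ + d₃, d₂ + d₃] : Fin 11 → ℕ) [2 * e, e + d₀, e + d₁, d₀ + d₁, d₀ + d₂, d₀ + d₃, d₂ + d₃] (![dJ, w₀ * m₀, w₁ * m₁, w₂ * m₂, w₃ * m₃, w₀ * w₁ * D01, w₀ * w₂ * D02, w₀ * w₃ * D03, w₁ * w₂ * D12, w₁ * w₃ * D13, w₂ * w₃ * D23] : Fin 11 → ℝ)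
    have hfour : (∑ i ∈ (Finset.univ : Finset (Fin 11)), Polynomial.C ((![dJ, w₀ * m₀, w₁ * m₁, w₂ * m₂, w₃ * m₃, w₀ * w₁ * D01, w₀ * w₂ * D02, w₀ * w₃ * D03, w₁ * w₂ * D12, w₁ * w₃ * D13, w₂ * w₃ * D23] : Fin 11 → ℝ) i
            * (([2 * e, e + d₀, e + d₁, d₀ + d₁, d₀ + d₂, d₀ + d₃, d₂ + d₃]).map (fun ρ : ℕ => (((((![2 * e, e + d₀, e + d₁, e + d₂, e + d₃, d₀ + d₁, d₀ + d₂, d₀ + d₃, d₁ + d₂, d₁ + d₃, d₂ + d₃] : Fin 11 → ℕ)) i : ℕ) : ℝ) - (ρ : ℝ)))).prod) * X ^ ((![2 * e, e + d₀, e + d₁, e + d₂, e + d₃, d₀ + d₁, d₀ + d₂, d₀ + d₃, d₁ + d₂, d₁ + d₃, d₂ + d₃] : Fin 11 → ℕ) i))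
        = (Polynomial.C A * X ^ (e + d₂) - Polynomial.C B * X ^ (e + d₂ + (d₁ - e))
            + Polynomial.C C * X ^ (e + d₂ + (d₃ - d₂)) - Polynomial.C D * X ^ (e + d₂ + (d₁ - e) + (d₃ - d₂))) := by
      have e3 : e + d₂ + (d₁ - e) + (d₃ - d₂) = d₁ + d₃ := by omega
      have e1 : e + d₂ + (d₁ - e) = d₁ + d₂ := by omega
      have e2 : e + d₂ + (d₃ - d₂) = e + d₃ := by omega
      rw [e3, e1, e2]
      have hcoef : ∀ i : Fin 11, (![dJ, w₀ * m₀, w₁ * m₁, w₂ * m₂, w₃ * m₃, w₀ * w₁ * D01, w₀ * w₂ * D02, w₀ * w₃ * D03, w₁ * w₂ * D12, w₁ * w₃ * D13, w₂ * w₃ * D23] : Fin 11 → ℝ) i * (([2 * e, e + d₀, e + d₁, d₀ + d₁, d₀ + d₂, d₀ + d₃, d₂ + d₃]).map (fun ρ : ℕ => (((((![2 * e, e + d₀, e + d₁, e + d₂, e + d₃, d₀ + d₁, d₀ + d₂, d₀ + d₃, d₁ + d₂, d₁ + d₃, d₂ + d₃] : Fin 11 → ℕ)) i : ℕ) : ℝ)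 - (ρ : ℝ)))).prod
          = (![0, 0, 0, A, C, 0, 0, 0, -B, -D, 0] : Fin 11 → ℝ) i := by
        intro i
        fin_cases i <;>
          simp only [Fin.zero_eta, Fin.mk_one, Fin.isValue, Matrix.cons_val_zero, Matrix.cons_val_one,
            List.map_cons, List.map_nil, List.prod_cons, List.prod_nil, hA, hB, hC, hD, hPA, hPB, hPC, hPD] <;>
          push_cast <;> ring
      rw [Finset.sum_congr rfl (fun i _ => by rw [hcoef i])]
      simp only [Fin.sum_univ_succ, Fin.sum_univ_zero, Matrix.cons_val_zero, Matrix.cons_val_succ, map_zero, zero_mul,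
        zero_add, add_zero, Polynomial.C_neg]
      ring
    rw [hfour] at hkills
    have hone := countP_posRoots_fourNomial_le_one A B C D hBp hDp hBC (e + d₂) (d₁ - e) (d₃ - d₂) (by omega)
    simp only [List.length_cons, List.length_nil] at hkills
    omega
  have hodd := elevenNomial_oneThree_odd e d₀ d₁ d₂ d₃ h0e he1 h12 h23 dJ m₀ m₁ m₂ m₃ w₀ w₁ w₂ w₃ D01 D02 D03 D12 D13 D23
    (mul_neg_of_pos_of_neg hw₀ hm₀) (mul_pos (mul_pos hw₂ hw₃) hD23)
  have h7 := card_posRoots_le_pred_of_odd _ 4 hodd (by omega)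
  omega

/-- **Matrix form: `Z₊ ≤ 7`** (as the tree's `oneThree_rankOne_posRoots_le_eight_of_par_s2p12s3p13`, plus letter `0` core, letters `2, 3` not parallel, positive weights). -/
theorem oneThree_rankOne_posRoots_le_seven_of_par_s2p12s3p13 (e d₀ d₁ d₂ d₃ : ℕ) (h0e : d₀ < e) (he1 : e < d₁) (h12 : d₁ < d₂)
    (h23 : d₂ < d₃) (hC1 : d₀ + d₁ < 2 * e) (hC2 : 2 * e < d₀ + d₂) (hC3 : d₀ + d₂ < e + d₁) (hC4 : e + d₁ < d₀ + d₃)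
    (hC5 : d₀ + d₃ < e + d₂) (hC6 : d₁ + d₂ < e + d₃)
    (J : Matrix (Fin 2) (Fin 2) ℝ) (v₀ v₁ v₂ v₃ : Fin 2 → ℝ) (w₀ w₁ w₂ w₃ : ℝ) (hw₁ : 0 < w₁) (hw₂ : 0 < w₂) (hw₃ : 0 < w₃) (hD12 : 0 < ((v₁ 0 * v₂ 1 - v₁ 1 * v₂ 0) ^ 2)) (hD13 : 0 < ((v₁ 0 * v₃ 1 - v₁ 1 * v₃ 0) ^ 2))
    (hw₀ : 0 < w₀) (hm₀ : (J 0 0 * v₀ 1 ^ 2 + J 1 1 * v₀ 0 ^ 2 - (J 0 1 + J 1 0) * (v₀ 0 * v₀ 1)) < 0) (hD23 : 0 < (v₂ 0 * v₃ 1 - v₂ 1 * v₃ 0) ^ 2)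
    (hS : (((v₁ 0 * v₂ 1 - v₁ 1 * v₂ 0) ^ 2) * (((d₁ : ℝ) + d₂ - 2 * e) * ((d₁ : ℝ) + d₂ - e - d₀) * ((d₂ : ℝ) - e) * ((d₂ : ℝ) - d₀) * ((d₁ : ℝ) - d₀) * ((d₁ : ℝ) + d₂ - d₀ - d₃) * ((d₃ : ℝ) - d₁))) * (((-(J 0 0 * v₃ 1 ^ 2 + J 1 1 * v₃ 0 ^ 2 - (J 0 1 + J 1 0) * (v₃ 0 * v₃ 1))) * (((d₃ : ℝ) - e) * ((d₃ : ℝ) - d₀) * ((d₃ : ℝ) - d₁) * ((e : ℝ) + d₃ - d₀ - d₁) * ((e : ℝ) + d₃ - d₀ - d₂) * ((e : ℝ) - d₀) * ((d₂ : ℝ) - e)))) ≤ (((-(J 0 0 * v₂ 1 ^ 2 + J 1 1 * v₂ 0 ^ 2 - (J 0 1 + J 1 0) * (v₂ 0 * v₂ 1))) * (((d₂ : ℝ) - e) * ((d₂ : ℝ) - d₀) * ((d₂ : ℝ) - d₁) * ((e : ℝ) + d₂ - d₀ - d₁) * ((e : ℝ) - d₀) * ((e : ℝ) + d₂ - d₀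 - d₃) * ((d₃ : ℝ) - e)))) * (((v₁ 0 * v₃ 1 - v₁ 1 * v₃ 0) ^ 2) * (((d₁ : ℝ) + d₃ - 2 * e) * ((d₁ : ℝ) + d₃ - e - d₀) * ((d₃ : ℝ) - e) * ((d₃ : ℝ) - d₀) * ((d₁ : ℝ) + d₃ - d₀ - d₂) * ((d₁ : ℝ) - d₀) * ((d₂ : ℝ) - d₁)))) :
    ((Matrix.det (((X : ℝ[X]) ^ e) • J.map Polynomial.C
        + (Polynomial.C w₀ * X ^ d₀) • (vecMulVec v₀ v₀).map Polynomial.C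
        + (Polynomial.C w₁ * X ^ d₁) • (vecMulVec v₁ v₁).map Polynomial.C
        + (Polynomial.C w₂ * X ^ d₂) • (vecMulVec v₂ v₂).map Polynomial.C
        + (Polynomial.C w₃ * X ^ d₃) • (vecMulVec v₃ v₃).map Polynomial.C)).roots.toFinset.filter (fun t => 0 < t)).card
      ≤ 7 := by
  rw [det_rankOne_four_sum]
  exact elevenNomial_chamberC_par_s2p12s3p13_le_seven e d₀ d₁ d₂ d₃ h0e he1 h12 h23 hC1 hC2 hC3 hC4 hC5 hC6 J.det _ _ _ _ w₀ w₁ w₂ w₃ _ _ _ _ _ _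
    hw₁ hw₂ hw₃ hD12 hD13 hw₀ hm₀ hD23 hS

end Summit.ValiantsHypothesis.ValiantsHypothesis.Theorems.LacunarySymmetroidMatrixDescartes.Pivot.TwoDirections.BlockLaw
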